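import Summits.Parity.BatemanHorn.Theorems.SelbergDelangeRigidityLSDRealSegmentTypeI
import Summits.Parity.BatemanHorn.Theorems.SelbergDelangeRigidityLSDRealSegmentTailsLinear
import Summits.Parity.BatemanHorn.Theorems.SystemLSDRealSegment.Negative.OmegaWide
import Literature.NumberTheory.LFunctions.HallTenenbaumTheorem01
import HarnessLib

/-!
# Route `SelbergDelangeRigidity`, crux `LSDRealSegment` (stmt-Parity-9770), line
# `product-anatomy-subcritical`: the beyond-level kernel law for total degree `≤ 1`
# (helper of `stub_reconstructionUnit`)

`kernelLaw_of_sum_natDegree_le_one` (registered helper): for every Bateman–Horn system `f` with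
`Σ deg fᵢ ≤ 1` and every real `1 < y < 2`, `KernelLawOmega k f y` holds, i.e.
`x⁻¹ (log x)^{k(1−y)} K_x(y) → λ_F(y) (D^{y−1} Γ(y)^{−k} − Γ(k(y−1)+1)^{−1})`, `D = ∏ deg fᵢ`.
These systems are the EMPTY system (`k = 0`: `P(n) = 1` has no divisor `> x`, so `K_x = 0` for `x ≥ 1`, and the
constant is `λ · (1 · 1 − Γ(1)⁻¹) = 0`) and ONE LINEAR FORM `f₀ = aX + b`, `a ≥ 1` (`k = 1`, `D = 1`, constant
`λ(y)(Γ(y)⁻¹ − Γ(y)⁻¹) = 0`).  For the linear form a divisor `d > x` of a value `an + b ≤ ax + b` has co-divisor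
`m = (an+b)/d < a + |b| =: L`, and for fixed `m` the values `(an+b)/m` are distinct, so
`K_x ≤ L · Σ_{w ≤ (a+|b|)x} g_y(w)` (`kernelSum_linear_le`).  The mean value of the un-capped weight `g_y`
(`g_y(p) = y − 1`, `g_y(p^ν) = (y−1)y^{ν−1}`) is `Σ_{w ≤ N} g_y(w) ≤ C N (log N)^{y−2}` (`sum_omegaWeight_le`):
Hall–Tenenbaum Theorem 01 (`Literature.NumberTheory.LFunctions.HallTenenbaum.theorem01`, PROVED) with (A) from
Chebyshev (`g_y(p) ≤ 1`) and (B) from the prime-power control (H2) of `typeI_local` at the system `(X)` — this is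
where `y < 2` enters, at `p = 2` —, times the logarithmic mean `Σ_{w ≤ N} g_y(w)/w ≪ (log N)^{y−1}`
(`typeI_levinFainleib` at the system `(X)`, `ρ_X ≡ 1`).  Hence `x⁻¹(log x)^{1−y} K_x ≪ 1/log x → 0`.
-/

open Filter Finset Polynomial
open scoped BigOperators Topology Classical

namespace Summit.Parity.BatemanHorn.Cruxes.LSDRealSegment.ProductAnatomySubcritical

open Literature.NumberTheory.Sieve
open ArithmeticFunction (cardFactors)
open Summit.Parity.BatemanHorn.Theorems.SystemLSDRealSegment.Negative (isBatemanHornSystem_X)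
noncomputable section

/-! ### The mean value of `g_y`: `Σ_{w ≤ N} g_y(w) ≪ N (log N)^{y−2}` -/

/-- `ρ_X(m) = 1` for every modulus `m ≥ 1` (the only root of `X` modulo `m` is `0`). [folklore] -/
theorem polyRootCountMod_X_of_pos {m : ℕ} (hm : 0 < m) : polyRootCountMod (![X] : Fin 1 → ℤ[X]) m = 1 := by
  unfold polyRootCountMod
  have : ((Finset.range m).filter fun n : ℕ => (m : ℤ) ∣ ∏ i, ((![X] : Fin 1 → ℤ[X]) i).eval (n : ℤ)) = {0} := by
    ext n
    simp only [Finset.mem_filter, Finset.mem_range, Finset.mem_singleton, Fin.prod_univ_one,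
      Matrix.cons_val_fin_one, eval_X, Int.natCast_dvd_natCast]
    constructor
    · rintro ⟨hn, hdvd⟩
      exact Nat.eq_zero_of_dvd_of_lt hdvd hn
    · rintro rfl
      exact ⟨hm, dvd_zero m⟩
  rw [this, Finset.card_singleton]

/-- `g_y` is multiplicative on coprime arguments, zero cases included (`Coprime 0 n ↔ n = 1`). [folklore] -/
theorem omegaWeight_mul_of_coprime (y : ℝ) (m n : ℕ) (h : m.Coprime n) :
    omegaWeight y (m * n) = omegaWeight y m * omegaWeight y n := by
  rcases eq_or_ne m 0 with rfl | hm
  · obtain rfl : n = 1 := by simpa using h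
    simp [omegaWeight_one]
  rcases eq_or_ne n 0 with rfl | hn
  · obtain rfl : m = 1 := by simpa using h
    simp [omegaWeight_one]
  exact omegaWeight_mul y hm hn h

/-- `g_y(p) = y − 1` at a prime. [folklore] -/
theorem omegaWeight_prime (y : ℝ) {p : ℕ} (hp : p.Prime) : omegaWeight y p = y - 1 := by
  have := omegaWeight_prime_pow y hp 1
  rw [pow_one] at this
  rw [this, omegaCoeff_succ, pow_zero, mul_one]

/-- The system `(X)` carries `g_y`: its Type-I coefficient is `b(m) = g_y(m)/m` (`ρ_X ≡ 1`), so `typeI_local` and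
`typeI_levinFainleib` give (i) the logarithmic mean `Σ_{w ≤ N} g_y(w)/w ≤ c (log N)^{y−1}` eventually and
(ii) Hall–Tenenbaum's hypothesis (B) `Σ_{p ≤ Y} Σ_{2 ≤ ν ≤ Y} g_y(p^ν) log p^ν / p^ν ≤ B` (`y < 2` at `p = 2`). [folklore] -/
theorem omegaWeight_logMean_and_hypB {y : ℝ} (hy : 1 ≤ y) (hy2 : y < 2) :
    (∃ c : ℝ, 0 ≤ c ∧ ∀ᶠ N : ℕ in atTop, ∑ w ∈ Icc 1 N, omegaWeight y w / w ≤ c * Real.log N ^ (y - 1)) ∧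
    (∃ B : ℝ, ∀ Y : ℕ, ∑ p ∈ Nat.primesLE Y, ∑ ν ∈ Icc 2 Y,
        omegaWeight y (p ^ ν) / (p : ℝ) ^ ν * Real.log ((p : ℝ) ^ ν) ≤ B) := by
  obtain ⟨g, hg⟩ : ∃ g : ℕ → ℝ, ∀ m, g m =
      omegaWeight y m * (polyRootCountMod (![X] : Fin 1 → ℤ[X]) m : ℝ) / m := ⟨_, fun _ => rfl⟩
  obtain ⟨hg0, hg1, hgmul, hH1, hH2, -⟩ := typeI_local 1 ![X] isBatemanHornSystem_X y hy hy2 g hg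
  have hgw : ∀ m, 0 < m → g m = omegaWeight y m / m := fun m hm => by
    rw [hg, polyRootCountMod_X_of_pos hm, Nat.cast_one, mul_one]
  constructor
  · have hκ0 : 0 ≤ ((1 : ℕ) : ℝ) * (y - 1) := by rw [Nat.cast_one, one_mul]; linarith
    obtain ⟨P, hP0, -, hG⟩ := typeI_levinFainleib g (((1 : ℕ) : ℝ) * (y - 1)) hκ0 hg0 hg1 hgmul hH1 hH2
    rw [Nat.cast_one, one_mul] at hG
    have hΓ : 0 < Real.Gamma (y - 1 + 1) := Real.Gamma_pos_of_pos (by linarith)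
    set c : ℝ := P / Real.Gamma (y - 1 + 1) + 1 with hc
    have hcpos : 0 < c := by positivity
    refine ⟨c, hcpos.le, ?_⟩
    have hev : ∀ᶠ N : ℕ in atTop, (∑ d ∈ Icc 1 N, g d) / Real.log N ^ (y - 1) < c :=
      hG.eventually (gt_mem_nhds (by rw [hc]; linarith))
    filter_upwards [hev, eventually_ge_atTop 2] with N hN hN2
    have hN2' : (2 : ℝ) ≤ N := by exact_mod_cast hN2
    have hL : 0 < Real.log N ^ (y - 1) := Real.rpow_pos_of_pos (Real.log_pos (by linarith)) _
    rw [div_lt_iff₀ hL] at hN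
    have heq : ∑ w ∈ Icc 1 N, omegaWeight y w / w = ∑ d ∈ Icc 1 N, g d :=
      Finset.sum_congr rfl fun d hd => (hgw d (Finset.mem_Icc.mp hd).1).symm
    rw [heq]
    exact hN.le
  · obtain ⟨A, hA⟩ := hH2
    refine ⟨A, fun Y => ?_⟩
    have h1 : 0 ≤ ∑ p ∈ Nat.primesLE Y, g p ^ 2 * Real.log p :=
      Finset.sum_nonneg fun p _ => mul_nonneg (sq_nonneg _) (Real.log_natCast_nonneg p)
    have h2 : ∑ p ∈ Nat.primesLE Y, ∑ ν ∈ Icc 2 Y, omegaWeight y (p ^ ν) / (p : ℝ) ^ ν * Real.log ((p : ℝ) ^ ν) =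
        ∑ p ∈ Nat.primesLE Y, ∑ ν ∈ Icc 2 Y, g (p ^ ν) * Real.log ((p : ℝ) ^ ν) := by
      refine Finset.sum_congr rfl fun p hp => Finset.sum_congr rfl fun ν _ => ?_
      have hp' := Nat.prime_of_mem_primesLE hp
      rw [hgw (p ^ ν) (pow_pos hp'.pos ν)]
      push_cast
      ring
    rw [h2]
    linarith [hA Y]

/-- **Mean value of the un-capped weight** (`1 ≤ y < 2`): `Σ_{w ≤ N} g_y(w) ≤ C N (log N)^{y−2}` for `N ≥ N₀` —
Hall–Tenenbaum Theorem 01 (`Σ_{n ≤ x} g ≤ (A+B+1) x/log x · Σ_{n ≤ x} g(n)/n`, with (A) `= log 4` by Chebyshev since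
`g_y(p) = y − 1 ≤ 1`, and (B) from `omegaWeight_logMean_and_hypB`) times the logarithmic mean `≪ (log N)^{y−1}`.
[folklore] -/
theorem sum_omegaWeight_le {y : ℝ} (hy : 1 ≤ y) (hy2 : y < 2) :
    ∃ C : ℝ, 0 ≤ C ∧ ∃ N₀ : ℕ, ∀ N : ℕ, N₀ ≤ N →
      ∑ w ∈ Icc 1 N, omegaWeight y w ≤ C * ((N : ℝ) * Real.log N ^ (y - 2)) := by
  obtain ⟨⟨c, hc0, hG⟩, ⟨B, hB⟩⟩ := omegaWeight_logMean_and_hypB hy hy2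
  -- (A) with `A = log 4`
  have hA : ∀ z : ℝ, 0 ≤ z → ∑ p ∈ Nat.primesLE ⌊z⌋₊, omegaWeight y p * Real.log p ≤ Real.log 4 * z := by
    intro z hz
    have h := Literature.NumberTheory.LFunctions.HallTenenbaum.hypA_of_le_one
      (f := fun n => min (omegaWeight y n) 1) (fun n => min_le_right _ _) hz
    refine le_trans (le_of_eq (Finset.sum_congr rfl fun p hp => ?_)) h
    have hp' := Nat.prime_of_mem_primesLE hp
    rw [omegaWeight_prime y hp', min_eq_left (by linarith)]
  obtain ⟨N₁, hN₁⟩ := eventually_atTop.mp hG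
  have hB0 : 0 ≤ B := by simpa using hB 0
  have hl4 : 0 ≤ Real.log 4 := Real.log_nonneg (by norm_num)
  set K : ℝ := Real.log 4 + B + 1 with hK
  have hK0 : 0 ≤ K := by positivity
  refine ⟨K * c, by positivity, max N₁ 2, fun N hN => ?_⟩
  have hNN₁ : N₁ ≤ N := le_of_max_le_left hN
  have hN2 : 2 ≤ N := le_of_max_le_right hN
  have hN2' : (2 : ℝ) ≤ N := by exact_mod_cast hN2
  have hN1 : (1 : ℝ) < N := by linarith
  have hlog : 0 < Real.log N := Real.log_pos hN1
  have hT := Literature.NumberTheory.LFunctions.HallTenenbaum.theorem01 (f := omegaWeight y) (omegaWeight_one y)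
    (omegaWeight_mul_of_coprime y) (omegaWeight_nonneg hy) hA hB hN1
  rw [Nat.floor_natCast] at hT
  have hG' := hN₁ N hNN₁
  calc ∑ w ∈ Icc 1 N, omegaWeight y w
      ≤ (Real.log 4 + B + 1) * ((N : ℝ) / Real.log N) * ∑ w ∈ Icc 1 N, omegaWeight y w / w := hT
    _ ≤ (Real.log 4 + B + 1) * ((N : ℝ) / Real.log N) * (c * Real.log N ^ (y - 1)) :=
        mul_le_mul_of_nonneg_left hG' (by positivity)
    _ = K * c * ((N : ℝ) * Real.log N ^ (y - 2)) := by
        rw [hK, show y - 2 = (y - 1) - 1 by ring, Real.rpow_sub_one hlog.ne' (y - 1)]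
        ring

/-! ### The kernel of one linear form -/

/-- Inner step: for `1 ≤ v ≤ L x`, the divisors `d > x` of `v` have co-divisors `m = v/d < L`, so
`Σ_{d ∣ v, d > x} g_y(d) ≤ Σ_{m < L} [m ∣ v] g_y(v/m)`. [folklore] -/
theorem sum_divisors_gt_le {y : ℝ} (hy : 1 ≤ y) {v x L : ℕ} (hL : 1 ≤ L) (hv : v ≠ 0) (hvL : v ≤ L * x) :
    ∑ d ∈ v.divisors.filter (fun d => x < d), omegaWeight y d ≤
      ∑ m ∈ range L, if m ∣ v then omegaWeight y (v / m) else 0 := by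
  have hset : (range L).filter (fun m => m ∣ v) = v.divisors.filter (fun m => m < L) := by
    ext m
    simp only [Finset.mem_filter, Nat.mem_divisors, Finset.mem_range]
    tauto
  rw [← Finset.sum_filter, hset, Finset.sum_filter, Finset.sum_filter,
    ← Nat.sum_div_divisors v (fun d => if x < d then omegaWeight y d else 0)]
  refine Finset.sum_le_sum fun m _ => ?_
  by_cases h1 : x < v / m
  · have hmL : m < L := by
      by_contra h2
      have h3 : m * (x + 1) ≤ m * (v / m) := Nat.mul_le_mul_left m h1
      have h4 : m * (v / m) ≤ v := Nat.mul_div_le v m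
      have h5 : L * (x + 1) ≤ m * (x + 1) := Nat.mul_le_mul_right _ (not_lt.mp h2)
      rw [Nat.mul_succ] at h5
      omega
    rw [if_pos h1, if_pos hmL]
  · rw [if_neg h1]
    split_ifs
    · exact omegaWeight_nonneg hy _
    · exact le_rfl

section Linear

variable {f : Fin 1 → ℤ[X]} {a b : ℤ}

/-- **The kernel of `f₀ = aX + b` against the mean value of `g_y`**: for `x ≥ 1`,
`K_x(y) ≤ L · Σ_{w ≤ (ax+b)⁺} g_y(w)`, `L = a + |b|` (only `n` with `an + b ≥ 1` contribute; a divisor `d > x` of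
`an + b` has co-divisor `m < L`; for fixed `m` the map `n ↦ (an+b)/m` is injective into `[1, (ax+b)/m]`). [folklore] -/
theorem kernelSum_linear_le (ha : 0 < a) (heval : ∀ n : ℕ, (f 0).eval (n : ℤ) = a * n + b) {y : ℝ}
    (hy : 1 ≤ y) {x : ℕ} (hx : 1 ≤ x) :
    kernelSum f y x ≤ ((a.toNat + b.natAbs : ℕ) : ℝ) * ∑ w ∈ Icc 1 (a * x + b).toNat, omegaWeight y w := by
  set L : ℕ := a.toNat + b.natAbs with hL
  have hL1 : 1 ≤ L := by omega
  set N : ℕ := (a * x + b).toNat with hN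
  have hNL : N ≤ L * x := toNat_le_mul ha hx
  set S : Finset ℕ := (range (x + 1)).filter (fun n : ℕ => 1 ≤ a * n + b) with hS
  -- Step 1: only the `n` with `an + b ≥ 1` contribute, with `P(n) = an + b`
  have hK : kernelSum f y x =
      ∑ n ∈ S, ∑ d ∈ ((a * n + b).toNat).divisors.filter (fun d => x < d), omegaWeight y d := by
    unfold kernelSum
    rw [← Finset.sum_filter_add_sum_filter_not (range (x + 1)) (fun n : ℕ => 1 ≤ a * n + b)]
    have hzero : ∑ n ∈ (range (x + 1)).filter (fun n : ℕ => ¬1 ≤ a * n + b),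
        ∑ d ∈ (prodVal f n).divisors.filter (fun d => x < d), omegaWeight y d = 0 := by
      refine Finset.sum_eq_zero fun n hn => ?_
      have h := (Finset.mem_filter.mp hn).2
      have hP : prodVal f n = 1 := by
        rw [prodVal_fin_one, val, heval, show (a * n + b).toNat = 0 by omega]
        rfl
      rw [hP, Nat.divisors_one, Finset.filter_singleton, if_neg (by omega), Finset.sum_empty]
    rw [hzero, add_zero]
    refine Finset.sum_congr rfl fun n hn => ?_
    have h := (Finset.mem_filter.mp hn).2
    rw [prodVal_fin_one, val, heval, max_eq_left (by omega)]
  -- Step 2: the inner bound by co-divisors `m < L`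
  have hstep : ∀ n ∈ S, ∑ d ∈ ((a * n + b).toNat).divisors.filter (fun d => x < d), omegaWeight y d ≤
      ∑ m ∈ range L, (if m ∣ (a * n + b).toNat then omegaWeight y ((a * n + b).toNat / m) else 0) := by
    intro n hn
    have h := Finset.mem_filter.mp hn
    have hnx : n ≤ x := by have := Finset.mem_range.mp h.1; omega
    have hv0 : (a * n + b).toNat ≠ 0 := by omega
    have hnx' : (n : ℤ) ≤ x := by exact_mod_cast hnx
    have hvN : (a * n + b).toNat ≤ L * x :=
      (Int.toNat_le_toNat (by nlinarith : a * n + b ≤ a * x + b)).trans hNL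
    exact sum_divisors_gt_le hy hL1 hv0 hvN
  -- Step 3: for fixed `m`, the `n`-sum is at most `Σ_{w ≤ N} g_y(w)`
  have hcol : ∀ m ∈ range L,
      ∑ n ∈ S, (if m ∣ (a * n + b).toNat then omegaWeight y ((a * n + b).toNat / m) else 0) ≤
        ∑ w ∈ Icc 1 N, omegaWeight y w := by
    intro m _
    have h1 : ∑ n ∈ S, (if m ∣ (a * n + b).toNat then omegaWeight y ((a * n + b).toNat / m) else 0) ≤
        ∑ v ∈ Icc 1 N, (if m ∣ v then omegaWeight y (v / m) else 0) :=
      sum_toNat_le_sum_Icc ha (g := fun v => if m ∣ v then omegaWeight y (v / m) else 0)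
        (fun n hn => by have := Finset.mem_range.mp (Finset.mem_filter.mp hn).1; omega)
        (fun n hn => (Finset.mem_filter.mp hn).2) (fun v => by
          split_ifs
          · exact omegaWeight_nonneg hy _
          · exact le_rfl)
    refine h1.trans ?_
    rw [← Finset.sum_filter]
    rcases Nat.eq_zero_or_pos m with rfl | hm
    · rw [Finset.filter_false_of_mem, Finset.sum_empty]
      · exact Finset.sum_nonneg fun w _ => omegaWeight_nonneg hy w
      · intro v hv
        rw [zero_dvd_iff]
        have := (Finset.mem_Icc.mp hv).1
        omega
    · rw [sum_filter_dvd_eq hm N (fun v => omegaWeight y (v / m))]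
      rw [Finset.sum_congr rfl fun r _ => by rw [Nat.mul_div_cancel_left r hm]]
      exact Finset.sum_le_sum_of_subset_of_nonneg (Finset.Icc_subset_Icc_right (Nat.div_le_self N m))
        fun w _ _ => omegaWeight_nonneg hy w
  -- assembly
  calc kernelSum f y x = _ := hK
    _ ≤ ∑ n ∈ S, ∑ m ∈ range L,
          (if m ∣ (a * n + b).toNat then omegaWeight y ((a * n + b).toNat / m) else 0) :=
        Finset.sum_le_sum hstep
    _ = ∑ m ∈ range L, ∑ n ∈ S,
          (if m ∣ (a * n + b).toNat then omegaWeight y ((a * n + b).toNat / m) else 0) := Finset.sum_comm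
    _ ≤ ∑ _m ∈ range L, ∑ w ∈ Icc 1 N, omegaWeight y w := Finset.sum_le_sum hcol
    _ = (L : ℝ) * ∑ w ∈ Icc 1 N, omegaWeight y w := by
        rw [Finset.sum_const, Finset.card_range, nsmul_eq_mul]

/-- **The kernel of one linear form is `O(x (log x)^{y−2})`**: for `f₀ = aX + b` and `1 ≤ y < 2`, eventually
`K_x(y) ≤ B · x (log x)^{y−1} / log x` (`kernelSum_linear_le`, monotonicity in the length, `sum_omegaWeight_le` at
`N = L x`, and `(log Lx)^{y−2} ≤ (log x)^{y−2}`). [folklore] -/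
theorem kernelSum_linear_eventually_le (ha : 0 < a) (heval : ∀ n : ℕ, (f 0).eval (n : ℤ) = a * n + b) {y : ℝ}
    (hy : 1 ≤ y) (hy2 : y < 2) :
    ∃ B : ℝ, ∀ᶠ x : ℕ in atTop,
      kernelSum f y x ≤ B * ((x : ℝ) * Real.log x ^ (((1 : ℕ) : ℝ) * (y - 1)) / Real.log x) := by
  obtain ⟨C, hC0, N₀, hC⟩ := sum_omegaWeight_le hy hy2
  set L : ℕ := a.toNat + b.natAbs with hL
  have hL1 : 1 ≤ L := by omega
  refine ⟨(L : ℝ) * (C * L), ?_⟩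
  filter_upwards [eventually_ge_atTop (max N₀ 2)] with x hx
  have hxN : N₀ ≤ x := le_of_max_le_left hx
  have hx2 : 2 ≤ x := le_of_max_le_right hx
  have hx1 : 1 ≤ x := by omega
  have hxr : (2 : ℝ) ≤ x := by exact_mod_cast hx2
  have hx0 : (0 : ℝ) < x := by linarith
  have hlogx : 0 < Real.log x := Real.log_pos (by linarith)
  have hLx : N₀ ≤ L * x := hxN.trans (Nat.le_mul_of_pos_left x hL1)
  have hmono : ∑ w ∈ Icc 1 (a * x + b).toNat, omegaWeight y w ≤ ∑ w ∈ Icc 1 (L * x), omegaWeight y w :=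
    Finset.sum_le_sum_of_subset_of_nonneg (Finset.Icc_subset_Icc_right (toNat_le_mul ha hx1))
      fun w _ _ => omegaWeight_nonneg hy w
  have hS := hC (L * x) hLx
  have hLx' : (x : ℝ) ≤ ((L * x : ℕ) : ℝ) := by exact_mod_cast Nat.le_mul_of_pos_left x hL1
  have hlogLx : Real.log x ≤ Real.log ((L * x : ℕ) : ℝ) := Real.log_le_log hx0 hLx'
  have hpow : Real.log ((L * x : ℕ) : ℝ) ^ (y - 2) ≤ Real.log x ^ (y - 2) :=
    Real.rpow_le_rpow_of_nonpos hlogx hlogLx (by linarith)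
  calc kernelSum f y x ≤ (L : ℝ) * ∑ w ∈ Icc 1 (a * x + b).toNat, omegaWeight y w :=
        kernelSum_linear_le ha heval hy hx1
    _ ≤ (L : ℝ) * (C * (((L * x : ℕ) : ℝ) * Real.log ((L * x : ℕ) : ℝ) ^ (y - 2))) :=
        mul_le_mul_of_nonneg_left (hmono.trans hS) (Nat.cast_nonneg _)
    _ ≤ (L : ℝ) * (C * (((L * x : ℕ) : ℝ) * Real.log x ^ (y - 2))) := by gcongr
    _ = (L : ℝ) * (C * L) * ((x : ℝ) * Real.log x ^ (((1 : ℕ) : ℝ) * (y - 1)) / Real.log x) := by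
        rw [Nat.cast_one, one_mul, show y - 2 = (y - 1) - 1 by ring, Real.rpow_sub_one hlogx.ne' (y - 1)]
        push_cast
        ring

end Linear

/-! ### The empty system, the real-to-complex step, and the registered helper -/

/-- For the empty system `K_x = 0` for `x ≥ 1` (`P(n) = 1` has no divisor `> x`). [folklore] -/
theorem kernelSum_fin_zero (f : Fin 0 → ℤ[X]) (y : ℝ) {x : ℕ} (hx : 1 ≤ x) : kernelSum f y x = 0 := by
  unfold kernelSum
  refine Finset.sum_eq_zero fun n _ => ?_
  have hP : prodVal f n = 1 := by simp [prodVal]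
  rw [hP, Nat.divisors_one, Finset.filter_singleton, if_neg (by omega), Finset.sum_empty]

/-- **Real-to-complex step with a vanishing constant**: if `0 ≤ K_x ≤ B x (log x)^{k(y−1)}/log x` eventually and
the kernel constant `D^{y−1}Γ(y)^{−k} − Γ(k(y−1)+1)^{−1}` vanishes, then `KernelLawOmega k f y` (the normalised kernel
is real, `≪ 1/log x → 0`; normaliser `x⁻¹ e^{k(1−y) log log x} = (x (log x)^{k(y−1)})⁻¹`, `normaliser_ofReal_eq`).
[folklore] -/
theorem kernelLaw_of_eventually_le {k : ℕ} {f : Fin k → ℤ[X]} {y : ℝ} (hy : 1 ≤ y) {B : ℝ}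
    (hK : ∀ᶠ x : ℕ in atTop, kernelSum f y x ≤ B * ((x : ℝ) * Real.log x ^ ((k : ℝ) * (y - 1)) / Real.log x))
    (hc : Complex.exp (((y : ℂ) - 1) * (Real.log (∏ i, ((f i).natDegree : ℝ)) : ℂ)) * (Complex.Gamma y)⁻¹ ^ k =
      (Complex.Gamma ((k : ℂ) * ((y : ℂ) - 1) + 1))⁻¹) :
    KernelLawOmega k f y := by
  unfold KernelLawOmega
  rw [hc, sub_self, mul_zero]
  have hK0 : ∀ x, 0 ≤ kernelSum f y x := fun x =>
    Finset.sum_nonneg fun n _ => Finset.sum_nonneg fun d _ => omegaWeight_nonneg hy d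
  have hlog : Tendsto (fun x : ℕ => B / Real.log x) atTop (𝓝 0) :=
    tendsto_const_nhds.div_atTop (Real.tendsto_log_atTop.comp tendsto_natCast_atTop_atTop)
  have hreal : Tendsto (fun x : ℕ => kernelSum f y x / ((x : ℝ) * Real.log x ^ ((k : ℝ) * (y - 1)))) atTop
      (𝓝 0) := by
    refine tendsto_of_tendsto_of_tendsto_of_le_of_le' tendsto_const_nhds hlog ?_ ?_
    · filter_upwards [eventually_ge_atTop 2] with x hx
      have hx2 : (2 : ℝ) ≤ x := by exact_mod_cast hx
      exact div_nonneg (hK0 x) (mul_nonneg (by linarith) (Real.rpow_nonneg (Real.log_nonneg (by linarith)) _))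
    · filter_upwards [hK, eventually_ge_atTop 2] with x hx hx2
      have hx2' : (2 : ℝ) ≤ x := by exact_mod_cast hx2
      have hx0 : (0 : ℝ) < x := by linarith
      have hlogx : 0 < Real.log x := Real.log_pos (by linarith)
      have hD : 0 < (x : ℝ) * Real.log x ^ ((k : ℝ) * (y - 1)) := mul_pos hx0 (Real.rpow_pos_of_pos hlogx _)
      rw [div_le_iff₀ hD]
      calc kernelSum f y x ≤ _ := hx
        _ = B / Real.log x * ((x : ℝ) * Real.log x ^ ((k : ℝ) * (y - 1))) := by ring
  have hcplx := (Complex.continuous_ofReal.tendsto _).comp hreal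
  rw [Complex.ofReal_zero] at hcplx
  refine hcplx.congr' ?_
  filter_upwards [eventually_ge_atTop 2] with x hx
  rw [Function.comp_apply, normaliser_ofReal_eq k y hx]
  push_cast
  ring

/-- **kernelLaw_of_sum_natDegree_le_one** (registered helper of `stub_reconstructionUnit`, line
`product-anatomy-subcritical`): the beyond-level kernel law `KernelLawOmega k f y` for EVERY Bateman–Horn system of
total degree `≤ 1` and every real `1 < y < 2`, unconditionally.  These systems are the empty one (`K_x = 0`,
constant `1·1 − Γ(1)⁻¹ = 0`) and one linear form `aX + b` (`K_x ≪ x (log x)^{y−2}` by `kernelSum_linear_eventually_le`,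
constant `λ(y)(1^{y−1}Γ(y)⁻¹ − Γ(y)⁻¹) = 0`). [folklore] -/
theorem kernelLaw_of_sum_natDegree_le_one : ∀ (k : ℕ) (f : Fin k → ℤ[X]), IsBatemanHornSystem f →
    (∑ i, (f i).natDegree) ≤ 1 → ∀ y : ℝ, 1 < y → y < 2 → KernelLawOmega k f y := by
  intro k
  match k with
  | 0 =>
      intro f _ _ y hy _
      refine kernelLaw_of_eventually_le hy.le (B := 0) ?_ ?_
      · filter_upwards [eventually_ge_atTop 1] with x hx
        rw [kernelSum_fin_zero f y hx, zero_mul]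
      · simp [Complex.Gamma_one]
  | 1 =>
      intro f hf hdeg y hy hy2
      have h1 : (f 0).natDegree = 1 := by
        have := hf.natDegree_pos 0
        rw [Fin.sum_univ_one] at hdeg
        omega
      obtain ⟨a, b, ha, heval⟩ := exists_eval_eq_linear hf h1
      obtain ⟨B, hB⟩ := kernelSum_linear_eventually_le ha heval hy.le hy2
      refine kernelLaw_of_eventually_le hy.le hB ?_
      rw [Fin.prod_univ_one, h1]
      simp
  | k + 2 =>
      intro f hf hdeg y _ _
      exfalso
      have h2 : 2 ≤ ∑ i, (f i).natDegree :=
        calc 2 ≤ ∑ _i : Fin (k + 2), 1 := by simp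
          _ ≤ ∑ i, (f i).natDegree := Finset.sum_le_sum fun i _ => hf.natDegree_pos i
      omega

end

end Summit.Parity.BatemanHorn.Cruxes.LSDRealSegment.ProductAnatomySubcritical
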